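import Literature.MathematicalPhysics.QuantumManyBody.EnergyLocalization
import Literature.MathematicalPhysics.QuantumManyBody.LiebYngvasonDyson
import HarnessLib

/-!
# LSSY Lemma 5.2, first layer: Dyson's lemma needs only the kinetic energy near an encounter

Topic `Literature/MathematicalPhysics/QuantumManyBody`, companion of `EnergyLocalization.lean`
(named fact `LSSY2005_lemma52_periodic`, [LSSY2005, Lemma 5.2]) and of `LiebYngvasonDyson.lean`
(Dyson's Lemma 2.5 / Cor. 2.6, `LSSY2005_dysonBound_boxN_holds`).

The printed proof of Lemma 5.2 [LSSY2005, p. 25] splits the kinetic energy of particle `1` into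
`T^in` (inside `Ω_X^c = {x₁ : |x₁ - xⱼ| < R for some j}`) and `T^out` (on `Ω_X`), and observes
that "the estimates used for the proof of Theorem 2.4, in particular (2.43)" bound
`εT + (1-ε)(T^in + I)` alone from below — i.e. Dyson's Corollary 2.6, `H ≥ aW_R`, consumes only
the kinetic energy of each particle *within distance `R` of its nearest neighbour*: in the proof
of Cor. 2.6 Lemma 2.5 is applied in the Voronoi cell `B_j` of the nearest neighbour `xⱼ`, and
Lemma 2.5 in a region star-shaped with respect to `xⱼ` only integrates `|∇ψ|²` where `U(|x - xⱼ|)`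
can see it, so one may replace `B_j` by `B_j ∩ {|x - xⱼ| < R}` (still star-shaped), on which
`tᵢ < R`.

This file proves that refinement of the tree's `Dyson.dysonBound_boxN_holds`:

* `nearSet R i = {X | ∃ j ≠ i, |xᵢ - xⱼ| < R}`, `kineticInside R Ψ X = ∑ᵢ 1_{nearSet R i}(X) |∇ᵢΨ(X)|²`
  (`T^in` summed over the particles), with `kineticInside + kineticOutside ≤ kineticDensity`
  (`kineticOutside` of `EnergyLocalization.lean`; equality for `N ≥ 2`);
* `dysonBound_boxN_inside` — for `v ≥ 0` measurable of range `R₀ ≥ 0`, `R > R₀`, and every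
  `C¹` function `ψ` on `Λ_ℓ^n`:
  `a ∫_{Λ^n} W_R |ψ|² ≤ ∫_{Λ^n} (∑ᵢ 1{∃ j ≠ i, |xᵢ-xⱼ| < R}|∇ᵢψ|² + ∑_{i<j} v(|xᵢ-xⱼ|)|ψ|²)`.

## References

* [LSSY2005] E. H. Lieb, R. Seiringer, J. P. Solovej, J. Yngvason, *The Mathematics of the Bose
  Gas and its Condensation*, Oberwolfach Seminars 34, Birkhäuser 2005 (arXiv:cond-mat/0610117):
  Lemma 2.5 (2.36), Cor. 2.6 (2.40)–(2.43) p. 14; Lemma 5.2 (5.9)–(5.14), p. 25.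
-/

noncomputable section

open MeasureTheory Filter Metric Set
open scoped ENNReal NNReal

namespace Literature.MathematicalPhysics.QuantumManyBody.BoseGas

open Dyson

variable {N : ℕ}

/-! ### The kinetic energy inside the encounter region -/

/-- The **encounter region** of particle `i`: the configurations in which some other particle is
within distance `R` of `xᵢ`, `{X | ∃ j ≠ i, |xᵢ - xⱼ| < R}` (`= {tᵢ < R}` for `N ≥ 2`; empty for
`N ≤ 1`, where `nnDist` has the junk value `0`). This is `Ω^c_X` of (5.13) for `i = 1`.
[cite: LSSY2005, Lemma 5.2 (5.13)] -/
def nearSet (R : ℝ) (i : Fin N) : Set (Config N) :=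
  {X | ∃ j, j ≠ i ∧ dist (X i) (X j) < R}

/-- The kinetic energy density **inside the encounter region**:
`∑ᵢ 1{∃ j ≠ i, |xᵢ - xⱼ| < R} |∇ᵢΨ(X)|²` (`T^in` of (5.11), summed over the particles).
[cite: LSSY2005, Lemma 5.2 (5.11), (5.13)] -/
def kineticInside (R : ℝ) (Ψ : Config N → ℂ) (X : Config N) : ℝ≥0∞ :=
  ∑ i : Fin N, (nearSet R i).indicator (partialGradSq i Ψ) X

/-- The encounter region is measurable (open). [cite: LSSY2005, (5.13)] -/
theorem measurableSet_nearSet (R : ℝ) (i : Fin N) : MeasurableSet (nearSet (N := N) R i) := by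
  have : nearSet (N := N) R i = ⋃ j ∈ Finset.univ.erase i, {X : Config N | dist (X i) (X j) < R} := by
    ext X
    simp only [nearSet, mem_setOf_eq, mem_iUnion, Finset.mem_erase, Finset.mem_univ, and_true,
      exists_prop]
  rw [this]
  exact Finset.measurableSet_biUnion _ fun j _ =>
    measurableSet_lt ((measurable_config_apply i).dist (measurable_config_apply j)) measurable_const

/-- `kineticInside R Ψ` is measurable. [folklore] -/
theorem measurable_kineticInside (R : ℝ) (Ψ : Config N → ℂ) :
    Measurable (kineticInside R Ψ) :=
  Finset.measurable_sum _ fun i _ =>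
    (measurable_partialGradSq i Ψ).indicator (measurableSet_nearSet R i)

/-- In the encounter region `tᵢ < R`. [cite: LSSY2005, (5.8), (5.13)] -/
theorem nnDist_lt_of_mem_nearSet {R : ℝ} {i : Fin N} {X : Config N} (h : X ∈ nearSet R i) :
    nnDist X i < R := by
  obtain ⟨j, hj, hlt⟩ := h
  exact (nnDist_le_dist X hj).trans_lt hlt

/-- `T^in + T^out ≤ T` pointwise: `∑ᵢ 1{near}|∇ᵢΨ|² + ∑ᵢ 1{tᵢ ≥ R}|∇ᵢΨ|² ≤ |∇Ψ|²` (with equality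
for `N ≥ 2`; for `N ≤ 1` the first sum is `0`). [cite: LSSY2005, Lemma 5.2 (5.9)–(5.12)] -/
theorem kineticInside_add_kineticOutside_le (R : ℝ) (Ψ : Config N → ℂ) (X : Config N) :
    kineticInside R Ψ X + kineticOutside R Ψ X ≤ kineticDensity Ψ X := by
  rw [kineticDensity_eq_sum_partialGradSq, kineticInside, kineticOutside, ← Finset.sum_add_distrib]
  refine Finset.sum_le_sum fun i _ => ?_
  by_cases h : X ∈ nearSet R i
  · rw [indicator_of_mem h, indicator_of_notMem (show X ∉ {Y : Config N | R ≤ nnDist Y i} from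
      not_le.2 (nnDist_lt_of_mem_nearSet h)), add_zero]
  · rw [indicator_of_notMem h, zero_add]
    exact indicator_le_self _ _ _

/-- `T^in ≤ T` pointwise. [cite: LSSY2005, Lemma 5.2 (5.11)] -/
theorem kineticInside_le_kineticDensity (R : ℝ) (Ψ : Config N → ℂ) (X : Config N) :
    kineticInside R Ψ X ≤ kineticDensity Ψ X :=
  le_self_add.trans (kineticInside_add_kineticOutside_le R Ψ X)

namespace Dyson

variable {v : ℝ → ℝ≥0∞} {R₀ R : ℝ} {n : ℕ}

/-! ### Corollary 2.6 with the kinetic energy inside the encounter region only -/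

/-- The integrand of the refined right side for particle `i`: its kinetic density *where
`tᵢ < R`* plus half of its interactions. [cite: LSSY2005, Cor. 2.6 and Lemma 5.2 (5.14)] -/
def rhsDensityIn (v : ℝ → ℝ≥0∞) (R : ℝ) (i : Fin n) (ψ : Config n → ℂ) (X : Config n) : ℝ≥0∞ :=
  (nearSet R i).indicator (kineticOn (singleEmb i) ψ) X +
    2⁻¹ * (∑ j ∈ Finset.univ.erase i, v (dist (X i) (X j))) * ((‖ψ X‖₊ : ℝ≥0∞)) ^ 2

/-- `rhsDensityIn` is measurable. [folklore] -/
theorem measurable_rhsDensityIn (hv : Measurable v) (R : ℝ) (i : Fin n) {ψ : Config n → ℂ}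
    (hψ : ContDiff ℝ 1 ψ) : Measurable (rhsDensityIn v R i ψ) := by
  unfold rhsDensityIn
  have h2 : ∀ j, Measurable fun X : Config n => v (dist (X i) (X j)) := fun j =>
    hv.comp ((measurable_config_apply i).dist (measurable_config_apply j))
  have h3 : Measurable fun X => ((‖ψ X‖₊ : ℝ≥0∞)) ^ 2 := by
    have := hψ.continuous.measurable; fun_prop
  exact ((measurable_kineticOn _ hψ).indicator (measurableSet_nearSet R i)).add
    ((measurable_const.mul (Finset.measurable_sum _ fun j _ => h2 j)).mul h3)

/-- `U_R(|y - p|) |φ|²` vanishes outside the ball of radius `R` about `p`. [cite: LSSY2005, (2.44) (softU)] -/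
theorem dysonPotential_dist_eq_indicator (p : Space) (φ : Space → ℂ) (y : Space) :
    dysonPotential R₀ R (dist y p) * ((‖φ y‖₊ : ℝ≥0∞)) ^ 2 =
      (ball p R).indicator (fun y => dysonPotential R₀ R (dist y p) * ((‖φ y‖₊ : ℝ≥0∞)) ^ 2) y := by
  by_cases hy : y ∈ ball p R
  · rw [indicator_of_mem hy]
  · rw [indicator_of_notMem hy, dysonPotential_of_not_mem, zero_mul]
    exact fun h => hy (mem_ball.2 h.2)

/-- **The refined slice bound.** Fix particle `i`, the positions `Z` of the others (all in
`Λ_ℓ`), and `ψ ∈ C¹`. Then, integrating over the position `y ∈ Λ_ℓ` of particle `i`,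
`a ∫ U_R(tᵢ)|ψ|² dy ≤ ∫ (1{tᵢ < R}|∇ᵢψ|² + ½ ∑_{j≠i} v(|y - xⱼ|)|ψ|²) dy`: as in
`Dyson.slice_bound`, but Lemma 2.5 is applied in the part of each Voronoi cell within distance
`R` of its centre (star-shaped with respect to the centre; `U_R` vanishes beyond `R`), where
`tᵢ < R`. [cite: LSSY2005, Cor. 2.6 (2.40)–(2.42) and Lemma 5.2 (5.14)] -/
theorem slice_bound_inside (hv : Measurable v) (hR₀ : 0 ≤ R₀) (hvan : ∀ r, R₀ < r → v r = 0)
    (hR : R₀ < R) {ℓ : ℝ} (i : Fin n) {ψ : Config n → ℂ} (hψ : ContDiff ℝ 1 ψ)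
    (Z : {k // k ∉ Set.range (singleEmb i)} → Space) (hZ : ∀ j, Z j ∈ box ℓ) :
    scatteringLength v *
        ∫⁻ y in box ℓ, lhsDensity R₀ R i ψ (glueEquiv (singleEmb i) 0 ((fun _ => y), Z)) ≤
      ∫⁻ y in box ℓ, rhsDensityIn v R i ψ (glueEquiv (singleEmb i) 0 ((fun _ => y), Z)) := by
  classical
  set a := scatteringLength v with ha
  set e := glueEquiv (singleEmb i) 0 with he
  set X₀ : Config n := e ((fun _ => 0), Z) with hX₀
  set φ : Space → ℂ := fun y => ψ (e ((fun _ => y), Z)) with hφ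
  have hsl : ∀ y, φ y = slice (singleEmb i) 0 ψ Z (fun _ => y) := fun y => rfl
  have hφc : ContDiff ℝ 1 φ :=
    (contDiff_slice (singleEmb i) 0 hψ Z).comp (contDiff_pi.2 fun _ => contDiff_id)
  have hφm : Measurable φ := hφc.continuous.measurable
  set J := Finset.univ.erase i with hJ
  set c : Fin n → Set Space := fun j => vcell ℓ i X₀ j ∩ ball (X₀ j) R with hc
  have hcm : ∀ j, MeasurableSet (c j) := fun j =>
    (measurableSet_vcell ℓ i X₀ j).inter measurableSet_ball
  have hXself : ∀ y, e ((fun _ => y), Z) i = y := fun y => glueEquiv_single_apply_self i y Z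
  have hX : ∀ y (k : Fin n) (hk : k ≠ i), e ((fun _ => y), Z) k = X₀ k := fun y k hk => by
    rw [hX₀, he, glueEquiv_single_apply_of_ne i y Z hk, glueEquiv_single_apply_of_ne i 0 Z hk]
  have hX₀box : ∀ j, j ≠ i → X₀ j ∈ box ℓ := fun j hj => by
    rw [hX₀, he, glueEquiv_single_apply_of_ne i 0 Z hj]; exact hZ _
  -- the kinetic density of `φ` is the group kinetic density of `ψ`
  have hkin : ∀ y, gradSqC φ y = kineticOn (singleEmb i) ψ (e ((fun _ => y), Z)) := by
    intro y
    rw [show φ = fun y : Space => slice (singleEmb i) 0 ψ Z (fun _ => y) from funext hsl,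
      gradSqC_comp_const ((contDiff_slice (singleEmb i) 0 hψ Z).differentiable one_ne_zero),
      kineticDensity_slice (singleEmb i) 0 hψ Z]
  -- the encounter region of particle `i`, as a set of positions `y`
  set S : Set Space := {y | e ((fun _ => y), Z) ∈ nearSet R i} with hS
  have hSm : MeasurableSet S :=
    (measurableSet_nearSet R i).preimage (e.measurable.comp
      ((measurable_pi_lambda _ fun _ => measurable_id).prodMk measurable_const))
  have hcS : ∀ j ∈ J, c j ⊆ S := by
    intro j hj y hy
    have hji : j ≠ i := (Finset.mem_erase.1 hj).1
    refine ⟨j, hji, ?_⟩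
    rw [hXself, hX y j hji]
    exact mem_ball.1 hy.2
  -- the integrands in terms of `φ` and `X₀`
  set G : Fin n → Space → ℝ≥0∞ := fun j y =>
    dysonPotential R₀ R (dist y (X₀ j)) * ((‖φ y‖₊ : ℝ≥0∞)) ^ 2 with hG
  have hGm : ∀ j, Measurable (G j) := fun j =>
    ((measurable_dysonPotential R₀ R).comp (measurable_id.dist measurable_const)).mul (by fun_prop)
  -- step 1: pointwise cover by the Voronoi cells (as in `slice_bound`), then cut at radius `R`
  have hcover : ∀ y ∈ box ℓ, lhsDensity R₀ R i ψ (e ((fun _ => y), Z)) ≤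
      ∑ j ∈ J, (c j).indicator (G j) y := by
    intro y hy
    by_cases hJne : J.Nonempty
    · obtain ⟨j₀, hj₀, hmem, hdist⟩ := exists_mem_vcell i (e ((fun _ => y), Z)) hJne
        (by rwa [hXself])
      have hcell : vcell ℓ i (e ((fun _ => y), Z)) j₀ = vcell ℓ i X₀ j₀ := by
        simp only [vcell]
        congr 1
        refine iInter_congr fun k => iInter_congr fun hk => ?_
        rw [hX y k hk, hX y j₀ hj₀]
      rw [hXself, hcell] at hmem
      rw [hXself, hX y j₀ hj₀] at hdist
      calc lhsDensity R₀ R i ψ (e ((fun _ => y), Z)) = G j₀ y := by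
            simp only [lhsDensity, hG, hdist, hφ]
        _ = (ball (X₀ j₀) R).indicator (G j₀) y := dysonPotential_dist_eq_indicator _ _ _
        _ = (c j₀).indicator (G j₀) y := by
            simp only [hc, Set.indicator_apply, mem_inter_iff, hmem, true_and]
        _ ≤ ∑ j ∈ J, (c j).indicator (G j) y :=
            Finset.single_le_sum (f := fun j => (c j).indicator (G j) y) (fun _ _ => zero_le)
              (Finset.mem_erase.2 ⟨hj₀, Finset.mem_univ _⟩)
    · have : nnDist (e ((fun _ => y), Z)) i = 0 := by rw [nnDist, dif_neg hJne]
      simp [lhsDensity, this, dysonPotential_zero_of_nonneg hR₀]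
  -- step 2: integrate the cover and apply Lemma 2.5 in each truncated cell
  have hstar : ∀ j, j ≠ i → ∀ x ∈ c j, ∀ t ∈ Ioo (0 : ℝ) 1, X₀ j + t • (x - X₀ j) ∈ c j := by
    intro j hji x hx t ht
    refine ⟨vcell_star (hX₀box j hji) hx.1 ht, ?_⟩
    rw [mem_ball, dist_eq_norm, add_sub_cancel_left, norm_smul, Real.norm_of_nonneg ht.1.le]
    have hxR : ‖x - X₀ j‖ < R := by rw [← dist_eq_norm]; exact mem_ball.1 hx.2
    calc t * ‖x - X₀ j‖ ≤ 1 * ‖x - X₀ j‖ :=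
          mul_le_mul_of_nonneg_right ht.2.le (norm_nonneg _)
      _ < R := by rw [one_mul]; exact hxR
  have hstep2 : a * ∫⁻ y in box ℓ, lhsDensity R₀ R i ψ (e ((fun _ => y), Z)) ≤
      ∑ j ∈ J, ∫⁻ y in c j, gradSqC φ y + 2⁻¹ * v ‖y - X₀ j‖ * ((‖φ y‖₊ : ℝ≥0∞)) ^ 2 := by
    calc a * ∫⁻ y in box ℓ, lhsDensity R₀ R i ψ (e ((fun _ => y), Z))
        ≤ a * ∫⁻ y in box ℓ, ∑ j ∈ J, (c j).indicator (G j) y :=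
          mul_le_mul_right (setLIntegral_mono' (measurableSet_box ℓ) hcover) _
      _ = a * ∑ j ∈ J, ∫⁻ y in box ℓ, (c j).indicator (G j) y := by
          rw [lintegral_finsetSum _ fun j _ => (hGm j).indicator (hcm j)]
      _ = ∑ j ∈ J, a * ∫⁻ y in c j, G j y := by
          rw [Finset.mul_sum]
          refine Finset.sum_congr rfl fun j _ => ?_
          rw [lintegral_indicator (hcm j), Measure.restrict_restrict (hcm j),
            inter_eq_left.2 ((inter_subset_left).trans (vcell_subset_box ℓ i X₀ j))]
      _ ≤ _ := by
          refine Finset.sum_le_sum fun j hj => ?_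
          have hji : j ≠ i := (Finset.mem_erase.1 hj).1
          have := lemma25 hv hR₀ hvan hR (hcm j) (X₀ j) (hstar j hji) hφc
          simpa only [hG, dist_eq_norm] using this
  -- step 3: recombine; the kinetic terms live in `S`
  have hdisj : Set.PairwiseDisjoint (↑J : Set (Fin n)) c := fun j hj j' hj' hne =>
    (disjoint_vcell (Finset.mem_erase.1 hj).1 (Finset.mem_erase.1 hj').1 hne).mono
      inter_subset_left inter_subset_left
  have hunionS : (⋃ j ∈ J, c j) ⊆ box ℓ ∩ S :=
    iUnion₂_subset fun j hj => subset_inter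
      ((inter_subset_left).trans (vcell_subset_box ℓ i X₀ j)) (hcS j hj)
  have hvm : ∀ j, Measurable fun y : Space => 2⁻¹ * v ‖y - X₀ j‖ * ((‖φ y‖₊ : ℝ≥0∞)) ^ 2 :=
    fun j => (measurable_const.mul (hv.comp (measurable_id.sub_const _).norm)).mul (by fun_prop)
  have hstep3 : ∑ j ∈ J, ∫⁻ y in c j, gradSqC φ y + 2⁻¹ * v ‖y - X₀ j‖ * ((‖φ y‖₊ : ℝ≥0∞)) ^ 2 ≤
      ∫⁻ y in box ℓ, S.indicator (gradSqC φ) y +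
        ∑ j ∈ J, 2⁻¹ * v ‖y - X₀ j‖ * ((‖φ y‖₊ : ℝ≥0∞)) ^ 2 := by
    calc ∑ j ∈ J, ∫⁻ y in c j, gradSqC φ y + 2⁻¹ * v ‖y - X₀ j‖ * ((‖φ y‖₊ : ℝ≥0∞)) ^ 2
        = ∑ j ∈ J, ((∫⁻ y in c j, gradSqC φ y) +
            ∫⁻ y in c j, 2⁻¹ * v ‖y - X₀ j‖ * ((‖φ y‖₊ : ℝ≥0∞)) ^ 2) :=
          Finset.sum_congr rfl fun j _ => lintegral_add_left (measurable_gradSqC hφc) _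
      _ = (∑ j ∈ J, ∫⁻ y in c j, gradSqC φ y) +
            ∑ j ∈ J, ∫⁻ y in c j, 2⁻¹ * v ‖y - X₀ j‖ * ((‖φ y‖₊ : ℝ≥0∞)) ^ 2 :=
          Finset.sum_add_distrib
      _ ≤ (∫⁻ y in box ℓ, S.indicator (gradSqC φ) y) +
            ∑ j ∈ J, ∫⁻ y in box ℓ, 2⁻¹ * v ‖y - X₀ j‖ * ((‖φ y‖₊ : ℝ≥0∞)) ^ 2 := by
          refine add_le_add ?_ (Finset.sum_le_sum fun j _ =>
            lintegral_mono_set ((inter_subset_left).trans (vcell_subset_box ℓ i X₀ j)))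
          rw [← lintegral_biUnion_finset hdisj fun j _ => hcm j]
          calc ∫⁻ y in ⋃ j ∈ J, c j, gradSqC φ y ≤ ∫⁻ y in box ℓ ∩ S, gradSqC φ y :=
                lintegral_mono_set hunionS
            _ = ∫⁻ y in box ℓ, S.indicator (gradSqC φ) y := by
                rw [inter_comm, ← Measure.restrict_restrict hSm, lintegral_indicator hSm]
      _ = _ := by
          rw [← lintegral_finsetSum _ fun j _ => hvm j,
            ← lintegral_add_left ((measurable_gradSqC hφc).indicator hSm)]
  -- step 4: identify the right side
  have hrhs : ∀ y, rhsDensityIn v R i ψ (e ((fun _ => y), Z)) =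
      S.indicator (gradSqC φ) y + ∑ j ∈ J, 2⁻¹ * v ‖y - X₀ j‖ * ((‖φ y‖₊ : ℝ≥0∞)) ^ 2 := by
    intro y
    rw [rhsDensityIn, Finset.mul_sum, Finset.sum_mul]
    congr 1
    · by_cases hy : y ∈ S
      · rw [indicator_of_mem hy, indicator_of_mem (show e ((fun _ => y), Z) ∈
          nearSet R i from hy), hkin]
      · rw [indicator_of_notMem hy, indicator_of_notMem (show e ((fun _ => y), Z) ∉
          nearSet R i from hy)]
    · refine Finset.sum_congr rfl fun j hj => ?_
      rw [hXself, hX y j (Finset.mem_erase.1 hj).1, dist_eq_norm]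
  calc a * ∫⁻ y in box ℓ, lhsDensity R₀ R i ψ (e ((fun _ => y), Z)) ≤ _ := hstep2
    _ ≤ _ := hstep3
    _ = ∫⁻ y in box ℓ, rhsDensityIn v R i ψ (e ((fun _ => y), Z)) :=
        lintegral_congr fun y => (hrhs y).symm

/-- **Corollary 2.6, one particle, refined.** For every `i` and `ψ ∈ C¹`,
`a ∫_{Λ^n} U_R(tᵢ)|ψ|² ≤ ∫_{Λ^n} (1{tᵢ < R}|∇ᵢψ|² + ½ ∑_{j≠i} v(|xᵢ - xⱼ|)|ψ|²)`.
[cite: LSSY2005, Cor. 2.6 (2.40) and Lemma 5.2 (5.14)] -/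
theorem particle_bound_inside (hv : Measurable v) (hR₀ : 0 ≤ R₀) (hvan : ∀ r, R₀ < r → v r = 0)
    (hR : R₀ < R) (ℓ : ℝ) (i : Fin n) {ψ : Config n → ℂ} (hψ : ContDiff ℝ 1 ψ) :
    scatteringLength v * ∫⁻ X in boxN n ℓ, lhsDensity R₀ R i ψ X ≤
      ∫⁻ X in boxN n ℓ, rhsDensityIn v R i ψ X := by
  set B := Set.pi univ (fun _ : {k // k ∉ Set.range (singleEmb i)} => box ℓ) with hB
  have hBm : MeasurableSet B := MeasurableSet.univ_pi fun _ => measurableSet_box ℓ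
  rw [setLIntegral_boxN_eq_glue ℓ i (measurable_lhsDensity R₀ R i hψ),
    setLIntegral_boxN_eq_glue ℓ i (measurable_rhsDensityIn hv R i hψ)]
  refine (lintegral_const_mul_le _ _).trans (setLIntegral_mono' hBm fun Z hZ => ?_)
  exact slice_bound_inside hv hR₀ hvan hR i hψ Z (fun j => hZ j (mem_univ _))

/-- **Corollary 2.6 in the box, refined (the input of Lemma 5.2)**: for `v ≥ 0` measurable,
vanishing beyond `R₀ ≥ 0`, `R > R₀`, and every `C¹` function `ψ` on `Λ_ℓ^n`,
`a ∫_{Λ^n} W_R|ψ|² ≤ ∫_{Λ^n} (∑ᵢ 1{tᵢ < R}|∇ᵢψ|² + ∑_{i<j} v(|xᵢ-xⱼ|)|ψ|²)` — Dyson's bound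
`H ≥ aW_R` (2.43) uses only the kinetic energy inside the encounter region `{tᵢ < R}`.
[cite: LSSY2005, Cor. 2.6 (2.43) and Lemma 5.2 (5.14)] -/
theorem dysonBound_boxN_inside (hv : Measurable v) (hR₀ : 0 ≤ R₀) (hvan : ∀ r, R₀ < r → v r = 0)
    (n : ℕ) (ℓ : ℝ) (hR : R₀ < R) {ψ : Config n → ℂ} (hψ : ContDiff ℝ 1 ψ) :
    scatteringLength v * ∫⁻ X in boxN n ℓ, dysonW R₀ R X * ((‖ψ X‖₊ : ℝ≥0∞)) ^ 2 ≤
      ∫⁻ X in boxN n ℓ, kineticInside R ψ X + interaction v X * ((‖ψ X‖₊ : ℝ≥0∞)) ^ 2 := by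
  classical
  set a := scatteringLength v with ha
  have hψm : Measurable ψ := hψ.continuous.measurable
  have hlhs : ∀ X, dysonW R₀ R X * ((‖ψ X‖₊ : ℝ≥0∞)) ^ 2 = ∑ i, lhsDensity R₀ R i ψ X := fun X => by
    simp only [dysonW, lhsDensity, Finset.sum_mul]
  have hkin : ∀ i : Fin n, kineticOn (singleEmb i) ψ = partialGradSq i ψ := fun i =>
    funext fun X => kineticOn_singleEmb_eq_partialGradSq i ψ X
  have hrhs : ∀ X, ∑ i, rhsDensityIn v R i ψ X =
      kineticInside R ψ X + interaction v X * ((‖ψ X‖₊ : ℝ≥0∞)) ^ 2 := fun X => by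
    simp only [rhsDensityIn, hkin, Finset.sum_add_distrib, kineticInside]
    congr 1
    rw [← Finset.sum_mul, ← Finset.mul_sum, sum_sum_erase_eq_two_mul_interaction, ← mul_assoc,
      ENNReal.inv_mul_cancel two_ne_zero ENNReal.ofNat_ne_top, one_mul]
  calc a * ∫⁻ X in boxN n ℓ, dysonW R₀ R X * ((‖ψ X‖₊ : ℝ≥0∞)) ^ 2
      = a * ∑ i, ∫⁻ X in boxN n ℓ, lhsDensity R₀ R i ψ X := by
        simp_rw [hlhs]
        rw [lintegral_finsetSum _ fun i _ => measurable_lhsDensity R₀ R i hψ]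
    _ = ∑ i, a * ∫⁻ X in boxN n ℓ, lhsDensity R₀ R i ψ X := Finset.mul_sum _ _ _
    _ ≤ ∑ i, ∫⁻ X in boxN n ℓ, rhsDensityIn v R i ψ X :=
        Finset.sum_le_sum fun i _ => particle_bound_inside hv hR₀ hvan hR ℓ i hψ
    _ = ∫⁻ X in boxN n ℓ, ∑ i, rhsDensityIn v R i ψ X :=
        (lintegral_finsetSum _ fun i _ => measurable_rhsDensityIn hv R i hψ).symm
    _ = ∫⁻ X in boxN n ℓ, kineticInside R ψ X + interaction v X * ((‖ψ X‖₊ : ℝ≥0∞)) ^ 2 :=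
        lintegral_congr fun X => hrhs X

end Dyson

end Literature.MathematicalPhysics.QuantumManyBody.BoseGas

end
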